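import Summits.ABC.ABC.Theses.DefiniteXi
import Literature.NumberTheory.Automorphic.BrandtThetaSeriesHeckeAction
import Literature.NumberTheory.Automorphic.BrandtEigenvectorNonEisenstein
import Literature.NumberTheory.Automorphic.BrandtEigenvectorDegreeZero
import Literature.NumberTheory.Automorphic.BrandtHeckeProjector
import Literature.NumberTheory.Automorphic.BrandtMatrixDegree
import Literature.NumberTheory.EllipticCurves.CongruenceNumber
import Literature.NumberTheory.EllipticCurves.NewformsMultiplicityOneProofs
import Literature.NumberTheory.EllipticCurves.HeckeOperatorsModularFormQExpansion
import Literature.NumberTheory.EllipticCurves.HeckeOperatorsAdjointProofs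
import Literature.NumberTheory.EllipticCurves.RationalTwoTorsionModPIrreducibleProofs
import Literature.NumberTheory.EllipticCurves.NonEisensteinPrimeOfSurjective
import Literature.NumberTheory.EllipticCurves.SzpiroFreyConductorProofs
import Literature.NumberTheory.EllipticCurves.ModularCurveManinSemistableBridgeProofs
import Literature.NumberTheory.EllipticCurves.PastenSpectralDegreeProofs
import Literature.NumberTheory.EllipticCurves.PastenCongruenceModulusProofs
import Literature.NumberTheory.Automorphic.EichlerSubidealCount
import HarnessLib

/-!
# Sketch (stub-ideation k=2 · GEN 3 · FAMILY 2 RESHAPE) for `stub_xiDegreeComparison` of crux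
# `SteinbergCore` (route-ABC-DefiniteXi): THETA-LATTICE CONGRUENCE TRANSFER, prime-free core
# `ξ ∣ n · r_f` (H5core) ⟹ `p^{v_p ξ} ∣ r_f (p ≥ 5)` ⟹ `cps ξ ∣ cps deg D` ⟹ the stub with `C = 1`.

Helper-lemma signatures (sorried; `lean check` rc 0) for the plan
`STUB-IDEAS-stub_xiDegreeComparison-2.md` (gen 3).  Gen-3 deltas over gen-2 (file
`STUB_IDEAS_stub_xiDegreeComparison_2_Sketch.lean`, ns `…ThetaTransfer`, still elaborating): H1 in
the convention-proof ALL-PAIRS form `Θ_ij − Θ_kl ∈ S₂` (Pizer 1980 Prop. 2.15: all the norm-form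
lattices lie in ONE genus; the tree's `brandtTheta` has `a₀ = 1`); H2 cut into H2₀ (cuspidality of
`Σ_j v_j Θ_ij` on degree zero, XS from H1) + H2a (choice) + H2b (everything else from the coercion
formula); NEW prime-free transfer H5core `ξ ∣ |2 w_i φ_i ⟨φ,y⟩_w| · r_f` (one gcd/Bezout, no prime,
no non-Eisenstein input), from which the per-prime H5 is XS; degree zero of the eigen-line via the
UNCONDITIONAL `XiSetup.sum_eq_zero_of_mem_eigenLattice_lFunction'` (file `EichlerSubidealCount`;
the unprimed lemma carries an ideal-count hypothesis); H3, H4a, H4b, H4, H6 verbatim from gen 2.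
-/

set_option linter.dupNamespace false

noncomputable section

namespace Summit.ABC.ABC.Cruxes.SteinbergCore.ThetaTransferG3

open scoped MatrixGroups ModularForm Matrix
open CongruenceSubgroup
open Literature.NumberTheory.EllipticCurves Literature.NumberTheory.EllipticCurves.ModularForms
open Literature.NumberTheory.Automorphic Literature.NumberTheory.Automorphic.Brandt

/-! ## H1 — the one NAMED FACT (to type under `Literature/NumberTheory/Automorphic/`) -/

/-- **H1 (named fact; Pizer 1980 Prop. 2.15 and its proof, p. 355: "for 1 ≤ h ≤ H these quadratic
forms all lie in the same genus … theta series of quadratic forms in the same genus have the same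
behavior at all cusps, that is, their differences are cusp forms (see Siegel [47, p. 376])";
Siegel 1935).**  ALL-PAIRS form (gen 3): every difference of two Brandt theta series of one
definite setup is a cusp form, `Θ_ij − Θ_kl ∈ S₂(Γ₀(N⁺N⁻))` — the tree's `brandtTheta i j` is the
genuine theta series (`a₀ = 1`, `qExpansion_coeff_zero_brandtTheta`) of a lattice in the genus of
`(O, nrd)`, so no row/column convention enters. -/
def brandtTheta_sub_isCuspForm : Prop :=
  ∀ (Nplus Nminus : ℕ) (S : XiSetup Nplus Nminus) [Fintype (ClassSet S.O)] (i j k l : ClassSet S.O),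
    ModularForm.IsCuspForm (S.brandtTheta i j - S.brandtTheta k l)

/-! ## H2 — the theta row on degree-zero vectors is cuspidal; the packaged lift -/

/-- **H2₀ (XS, from H1).** For `v` of degree zero, `Σ_j v_j Θ_ij = Σ_j v_j (Θ_ij − Θ_ij₀)` is a
cusp form (`Finset.sum_sub_distrib`, `Finset.sum_smul`, `Submodule.sum_mem`/`smul_mem` in
`ModularForm.cuspFormSubmodule`; any `j₀`, e.g. `i`). -/
theorem isCuspForm_sum_smul_brandtTheta (hΘ : brandtTheta_sub_isCuspForm) {Nplus Nminus : ℕ}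
    (S : XiSetup Nplus Nminus) [Fintype (ClassSet S.O)] (i : ClassSet S.O)
    {v : ClassSet S.O → ℤ} (hv : ∑ j, v j = 0) :
    ModularForm.IsCuspForm (∑ j, (v j : ℂ) • S.brandtTheta i j) := by
  sorry

/-- **H2a (XS, choice).** A function `Θ_i : ℤ^{Cls O} → S₂(Γ₀(N⁺N⁻))` with
`(Θ_i v : M₂) = Σ_j v_j Θ_ij` on degree-zero `v` (junk `0` elsewhere):
`ModularForm.IsCuspForm` is membership in `LinearMap.range CuspForm.toModularFormₗ`. -/
theorem exists_thetaLift (hΘ : brandtTheta_sub_isCuspForm) {Nplus Nminus : ℕ}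
    (S : XiSetup Nplus Nminus) [Fintype (ClassSet S.O)] (i : ClassSet S.O) :
    ∃ Θ : (ClassSet S.O → ℤ) → CuspForm (Gamma0 (Nplus * Nminus)) 2,
      ∀ v : ClassSet S.O → ℤ, ∑ j, v j = 0 →
        ((Θ v : ModularForm (Gamma0 (Nplus * Nminus)) 2) = ∑ j, (v j : ℂ) • S.brandtTheta i j) := by
  sorry

/-- **H2b (S, everything else from the coercion formula alone).**  Any `Θ` as in H2a is additive and
`ℤ`-homogeneous on degree zero (injectivity of `CuspForm → ModularForm`), has `q`-coefficients
`a_n = 2 w_i (T(n) v)_i ∈ ℤ` (`XiSetup.qExpansion_coeff_sum_smul_brandtTheta`, `mem_integralCuspForms0`;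
`a₀ = 0` for a cusp form) and intertwines `T(p)` with `T_p` for `p ∤ N⁺N⁻`
(`XiSetup.modHeckeT_sum_smul_brandtTheta` + `coe_modHeckeT_coe_cuspForm`; `T(p)` preserves degree
zero by `XiSetup.sum_matrix_eq_sigma` + `sum_mulVec_eq_mul_sum`). -/
theorem thetaLift_spec {Nplus Nminus : ℕ} [NeZero (Nplus * Nminus)] (S : XiSetup Nplus Nminus)
    [Fintype (ClassSet S.O)] (i : ClassSet S.O)
    (Θ : (ClassSet S.O → ℤ) → CuspForm (Gamma0 (Nplus * Nminus)) 2)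
    (hΘ : ∀ v : ClassSet S.O → ℤ, ∑ j, v j = 0 →
      ((Θ v : ModularForm (Gamma0 (Nplus * Nminus)) 2) = ∑ j, (v j : ℂ) • S.brandtTheta i j)) :
    (∀ v w : ClassSet S.O → ℤ, ∑ j, v j = 0 → ∑ j, w j = 0 → Θ (v + w) = Θ v + Θ w) ∧
    (∀ (c : ℤ) (v : ClassSet S.O → ℤ), ∑ j, v j = 0 → Θ (c • v) = (c : ℂ) • Θ v) ∧
    (∀ v : ClassSet S.O → ℤ, ∑ j, v j = 0 →
      Θ v ∈ integralCuspForms0 (Nplus * Nminus) 2 ∧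
      (∀ n : ℕ, n ≠ 0 →
        cuspCoeff (Θ v) n = ((2 * (weight S.O i : ℤ) * (matrix S.O n *ᵥ v) i : ℤ) : ℂ)) ∧
      ∀ (p : ℕ) (hp : p.Prime), ¬ p ∣ Nplus * Nminus →
        (haveI : NeZero p := ⟨hp.ne_zero⟩; heckeT (Gamma0 (Nplus * Nminus)) 2 p (Θ v)) =
          Θ (matrix S.O p *ᵥ v)) := by
  sorry

/-! ## H3 — the eigen-line goes to `ℤ · f` EXACTLY (multiplicity one, proved in the tree) -/

/-- **H3 (image of the eigenvector).** If `φ` lies in the `a(W)`-eigen-lattice of the Brandt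
matrices and `f` is the newform of `W` at level `N⁺N⁻`, then a cusp form `g` with
`(g : M₂) = Σ_j φ_j Θ_{ij}` equals `(2 w_i φ_i) • f`: `g` is a `T_p`-eigenform with the eigenvalues
of `f` for all `p ∤ N` (`modHeckeT_sum_smul_brandtTheta_of_eigenvector`), hence in `ℂ f` by
`mem_span_of_equiv_of_mem_newSubspace0` (Atkin–Lehner multiplicity one, PROVED), and the multiple is
read off `a_1` (`qExpansion_coeff_one_sum_smul_brandtTheta`, `a_1(f) = 1`). -/
theorem thetaLift_eigenvector_eq_smul {Nplus Nminus : ℕ} [NeZero (Nplus * Nminus)]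
    (S : XiSetup Nplus Nminus) [Fintype (ClassSet S.O)] (i : ClassSet S.O)
    (W : WeierstrassCurve ℚ) [W.IsElliptic] {f : CuspForm (Gamma0 (Nplus * Nminus)) 2}
    (hf : IsNewformOf W f) {φ : ClassSet S.O → ℤ}
    (hφ : φ ∈ eigenLattice (Nplus * Nminus) (matrix S.O) fun n => W.LFunction n)
    (g : CuspForm (Gamma0 (Nplus * Nminus)) 2)
    (hg : (g : ModularForm (Gamma0 (Nplus * Nminus)) 2) = ∑ j, (φ j : ℂ) • S.brandtTheta i j) :
    g = (2 * (weight S.O i : ℂ) * (φ i : ℂ)) • f := by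
  sorry

/-! ## H4 — orthogonality transfer `z ⊥_w φ ⟹ Θ_i(z) ⊥_{Pet} f`, as TWO independent inductions -/

/-- **H4a (eigen-pairing along the good Hecke algebra; modular side only).** For `f` with
`T_p f = a_p f` (`a_p ∈ ℤ`) for all `p ∤ N`, every `M` in the `ℤ`-algebra generated by these `T_p`
acts on `f` by an integer `c_M` and `⟨f, M g⟩ = c_M ⟨f, g⟩` for all `g` — `Algebra.adjoin_induction`
with `heckeT_selfAdjoint_holds` (Knapp Thm. 9.18, PROVED) at each generator; no commutativity. -/
theorem exists_eigenvalue_peterssonProduct_eq {N : ℕ} [NeZero N] {k : ℤ}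
    (f : CuspForm (Gamma0 N) k) (a : ℕ → ℤ)
    (hf : ∀ (p : ℕ) (hp : p.Prime), ¬ p ∣ N →
      (haveI : NeZero p := ⟨hp.ne_zero⟩; heckeT (Gamma0 N) k p f) = (a p : ℂ) • f)
    {M : Module.End ℂ (CuspForm (Gamma0 N) k)}
    (hM : M ∈ Algebra.adjoin ℤ {X : Module.End ℂ (CuspForm (Gamma0 N) k) |
      ∃ (p : ℕ) (hp : p.Prime), ¬ p ∣ N ∧ X = (haveI : NeZero p := ⟨hp.ne_zero⟩; heckeT (Gamma0 N) k p)}) :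
    ∃ c : ℤ, M f = (c : ℂ) • f ∧
      ∀ g, peterssonProduct (Gamma0 N) k f (M g) = (c : ℂ) * peterssonProduct (Gamma0 N) k f g := by
  sorry

/-- **H4b (NEW · transport of the good Brandt–Hecke algebra through an equivariant lift; pure
algebra, Brandt-free).**  If `Θ : ℤ^ι → S_k(Γ₀(N))` is additive and `ℤ`-homogeneous on the
degree-zero vectors and intertwines `T(p)` with `T_p` there for every prime `p ∤ N`, and the `T(p)`
have constant column sums (so `ℤ[T(p) : p ∤ N]` preserves degree zero), then every
`M ∈ ℤ[T(p) : p ∤ N]` has a partner `M̃ ∈ ℤ[T_p : p ∤ N]` with `M̃ (Θ v) = Θ (M v)` on degree-zero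
`v` — `Algebra.adjoin_induction` (generators: hypothesis; `+`, `*`, scalars: linearity). -/
theorem exists_transport_adjoin {ι : Type*} [Fintype ι] [DecidableEq ι] {N : ℕ} [NeZero N] {k : ℤ}
    (T : ℕ → Matrix ι ι ℤ) (hcol : ∀ p : ℕ, p.Prime → ¬ p ∣ N → ∃ s : ℤ, ∀ j, ∑ i, T p i j = s)
    (Θ : (ι → ℤ) → CuspForm (Gamma0 N) k)
    (hadd : ∀ v w : ι → ℤ, ∑ j, v j = 0 → ∑ j, w j = 0 → Θ (v + w) = Θ v + Θ w)
    (hsmul : ∀ (c : ℤ) (v : ι → ℤ), ∑ j, v j = 0 → Θ (c • v) = (c : ℂ) • Θ v)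
    (hT : ∀ (p : ℕ) (hp : p.Prime), ¬ p ∣ N → ∀ v : ι → ℤ, ∑ j, v j = 0 →
      (haveI : NeZero p := ⟨hp.ne_zero⟩; heckeT (Gamma0 N) k p (Θ v)) = Θ (T p *ᵥ v))
    {M : Matrix ι ι ℤ}
    (hM : M ∈ Algebra.adjoin ℤ {X : Matrix ι ι ℤ | ∃ p : ℕ, p.Prime ∧ ¬ p ∣ N ∧ X = T p}) :
    ∃ Mt ∈ Algebra.adjoin ℤ {X : Module.End ℂ (CuspForm (Gamma0 N) k) |
        ∃ (p : ℕ) (hp : p.Prime), ¬ p ∣ N ∧ X = (haveI : NeZero p := ⟨hp.ne_zero⟩; heckeT (Gamma0 N) k p)},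
      ∀ v : ι → ℤ, ∑ j, v j = 0 → Mt (Θ v) = Θ (M *ᵥ v) := by
  sorry

/-- **H4 (orthogonality transfer; now a ten-line corollary of H4a + H4b).** With `L = ℤφ` the
eigen-line (`φ ≠ 0`, so `ξ = Σ w φ² > 0`) and `z` of degree zero with `⟨φ, z⟩_w = 0`:
`⟨f, Θ_i(z)⟩ = 0`.  Proof: the integral Hecke projector `M ∈ ℤ[T(p) : p ∤ N]`,
`ξ M_{cd} = D w_d φ_d φ_c`, `D > 0` (`Brandt.exists_heckeProjector` with `S.one_le_weight`,
`S.weight_mul_matrix_symm`) has `M z = 0`, `M φ = D φ`; its partner `M̃` (H4b) satisfies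
`M̃ f = D f` (via H3: `Θ φ = m f`, `m ≠ 0`) so H4a gives `D ⟨f, Θ z⟩ = ⟨f, M̃ Θ z⟩ = ⟨f, Θ(Mz)⟩ = 0`. -/
theorem peterssonProduct_thetaLift_eq_zero (hΘ : brandtTheta_sub_isCuspForm) {Nplus Nminus : ℕ}
    [NeZero (Nplus * Nminus)] (S : XiSetup Nplus Nminus) [Fintype (ClassSet S.O)]
    (i : ClassSet S.O) (W : WeierstrassCurve ℚ) [W.IsElliptic]
    {f : CuspForm (Gamma0 (Nplus * Nminus)) 2} (hf : IsNewformOf W f) {φ : ClassSet S.O → ℤ}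
    (hφ0 : φ ≠ 0) (hL : eigenLattice (Nplus * Nminus) (matrix S.O) (fun n => W.LFunction n) = ℤ ∙ φ)
    (hφi : φ i ≠ 0)
    {z : ClassSet S.O → ℤ} (hz0 : ∑ j, z j = 0)
    (hz : ∑ j, (weight S.O j : ℤ) * φ j * z j = 0)
    (g : CuspForm (Gamma0 (Nplus * Nminus)) 2)
    (hg : (g : ModularForm (Gamma0 (Nplus * Nminus)) 2) = ∑ j, (z j : ℂ) • S.brandtTheta i j) :
    peterssonProduct (Gamma0 (Nplus * Nminus)) 2 f g = 0 := by
  sorry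

/-! ## H5 — transfer of the lattice congruence to `r_f`: prime-free core, then prime-wise -/

/-- **H5core (NEW in gen 3 · prime-free transfer; M, the hardest helper).**  For the eigen-line
`ℤφ` of `a(W)` in a definite setup `S` of level `M = N⁺N⁻`, the newform `f` of `W` at level `M`,
ANY row `i` and ANY degree-zero `y`:  `ξ ∣ |n| · r_f` with `n = 2 w_i φ_i ⟨φ, y⟩_w`.
Proof: `z := ξ y − ⟨φ,y⟩_w φ` has degree `0` (`Σ φ = 0`:
`XiSetup.sum_eq_zero_of_mem_eigenLattice_lFunction'`) and `⟨φ, z⟩_w = 0` (`xi_eq_sum`); by H2/H3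
`n f = ξ Θ_i(y) − Θ_i(z)` in `S₂(ℤ)` with `Θ_i(z) ⊥ f` (H4; if `φ_i = 0` then `n = 0`, done); with
`g₀ = gcd(n, ξ)`, `n = g₀ n'`, `ξ = g₀ ξ'`, the form `G' = n' f − ξ' Θ_i(y) = g₀⁻¹ Θ_i(z)` is integral
and `⊥ f`; Bezout `α n' + β ξ' = 1` gives `f − (−α G') = ξ' • (α Θ_i(y) + β f)`, so `ξ' ∣ r_f`
(`dvd_congruenceNumber_of_sub_eq_smul`, `f ≠ 0`, `f ∈ S₂(ℤ)` from `hf.2`) and `ξ = g₀ ξ' ∣ |n| r_f`.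
No prime, no non-Eisenstein input; `subst hM` first. -/
theorem xi_dvd_mul_congruenceNumber (hΘ : brandtTheta_sub_isCuspForm) {Nplus Nminus M : ℕ}
    [NeZero M] (hM : Nplus * Nminus = M) (S : XiSetup Nplus Nminus) [Fintype (ClassSet S.O)]
    (W : WeierstrassCurve ℚ) [W.IsElliptic] {f : CuspForm (Gamma0 M) 2} (hf : IsNewformOf W f)
    {φ : ClassSet S.O → ℤ} (hφ0 : φ ≠ 0)
    (hL : eigenLattice (Nplus * Nminus) (matrix S.O) (fun n => W.LFunction n) = ℤ ∙ φ)
    (i : ClassSet S.O) {y : ClassSet S.O → ℤ} (hy : ∑ c, y c = 0) :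
    (S.xi fun n => W.LFunction n) ∣
      (2 * (weight S.O i : ℤ) * φ i * ∑ c, (weight S.O c : ℤ) * φ c * y c).natAbs *
        congruenceNumber f := by
  sorry

/-- **H5 (prime-wise; XS from H5core).**  For `p ≥ 5` with a good prime `ℓ`, `a_ℓ(W) ≢ ℓ + 1 (mod p)`:
`p^{v_p ξ} ∣ r_f`.  If `ξ = 0` trivial; else `ξ = S.xi = xi w (ℤφ)` is a line (`xi_of_not_isLine`),
`i` with `p ∤ φ_i` (`exists_not_dvd_of_eigenLattice_eq_span`), `p ∤ w_i` (`XiSetup.not_dvd_weight`),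
`y` of degree `0` with `p ∤ ⟨φ, y⟩_w` (`XiSetup.exists_sum_eq_zero_not_dvd_pairing`, `c₀ := i`), so
`p ∤ n`; H5core and `Nat.Coprime.dvd_of_dvd_mul_left` give `p^{v_p ξ} ∣ r_f`. -/
theorem ordProj_xi_dvd_congruenceNumber (hΘ : brandtTheta_sub_isCuspForm) {Nplus Nminus M : ℕ}
    [NeZero M] (hM : Nplus * Nminus = M) (S : XiSetup Nplus Nminus) [Fintype (ClassSet S.O)]
    (W : WeierstrassCurve ℚ) [W.IsElliptic] {f : CuspForm (Gamma0 M) 2}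
    (hf : IsNewformOf W f) {p : ℕ} (hp : p.Prime) (h5 : 5 ≤ p)
    (hℓ : ∃ ℓ : ℕ, ℓ.Prime ∧ ¬ ℓ ∣ M ∧ ¬ (p : ℤ) ∣ W.LFunction ℓ - (ℓ + 1)) :
    p ^ (S.xi fun n => W.LFunction n).factorization p ∣ congruenceNumber f := by
  sorry

/-! ## Guard and `cps` bookkeeping -/

/-- **Guard (junk-value catch — PROVED).** `congruenceNumber` is a `Nat.card`; for the newform of a
parametrisation datum it is `≠ 0` (it divides Pasten's positive product of congruence moduli). -/
theorem congruenceNumber_ne_zero {W : WeierstrassCurve ℚ} {N : ℕ} [NeZero N]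
    (D : ModularParametrizationData W N) : congruenceNumber D.f ≠ 0 :=
  (Nat.pos_of_dvd_of_pos D.congruenceNumber_dvd_prod_heckeCongruenceModulus
    D.prod_heckeCongruenceModulus_pos).ne'

/-- **H6a (XS · `cps x ∣ cps y` from prime-power divisibilities at `p ≥ 5`).**
`p ^ v_p(x) ∣ y`, `y ≠ 0` ⟹ `v_p x ≤ v_p y` (`Nat.Prime.pow_dvd_iff_le_factorization`); then compare
`cps x = ∏_{p ≥ 5} p^{v_p x}` (`Nat.factorization_prod_pow_eq_self` with `2, 3` removed) factorwise. -/
theorem primeToSix_dvd_of_forall_prime_pow_dvd {x y : ℕ} (hy : y ≠ 0)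
    (h : ∀ p : ℕ, p.Prime → 5 ≤ p → p ^ x.factorization p ∣ y) :
    x / (ordProj[2] x * ordProj[3] x) ∣ y / (ordProj[2] y * ordProj[3] y) := by
  sorry

/-! ## H6 — assembly of the stub with `C = 1` -/

/-- **H6 (assembly): the stub with `C = 1`, uniformly in the type `(N/Nm, Nm)`,** from H1, the
Mazur–Kenku isogeny fact (`hasIrreducibleModPGaloisRep_freyCurve_of_mazurKenku` +
`exists_prime_not_dvd_lFunction_sub_of_hasIrreducibleModPGaloisRep`), ARS 2012 Thm. 2.1(b)
(`padicValNat_congruenceNumber_eq_of_not_sq_dvd` at the lattice-optimal datum `D₀` of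
`D.exists_optimalDatum'`; `p² ∤ N` for `p ≥ 5` by `conductorNorm_freyCurve_dvd_holds`) and
`FreyModularity` (`exists_minimal_datum`).  ORDER (gen-2): fix `ε`, `C := 1`; given `a b N Nm` and
`ξ ≠ 0`: `D` minimal, `D₀` optimal with `D₀.f = D.f`, `deg D₀ ∣ deg D` (verbatim the lines of
`xiDegreeComparison_of_facts`); `r := congruenceNumber D.f ≠ 0` (guard); setup `S` with
`brandtXi = S.xi` (`exists_brandtXi_eq`); PRIMEWISE for `p ≥ 5`: H5 (`hM : N/Nm*Nm = N` by
`Nat.div_mul_cancel`) ⟹ `p^{v_p ξ} ∣ r` ⟹ `v_p ξ ≤ v_p r = v_p deg D₀ ≤ v_p deg D`; H6a ⟹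
`cps ξ ∣ cps deg D` ⟹ `≤` (`Nat.le_of_dvd`, `cps deg D > 0`); finally `1 ≤ N^ε`, `1 ≤ T³`
(`factorization_minimalDiscriminantNorm_pos_of_dvd`) as in `xiDegreeComparison_of_facts`. -/
theorem stub_xiDegreeComparison_of_thetaTransfer (hΘ : brandtTheta_sub_isCuspForm)
    (hMK : mazurKenku_exists_cyclic_isogeny)
    (hARS : padicValNat_congruenceNumber_eq_of_not_sq_dvd)
    (hMod : Summit.ABC.ABC.Theses.DefiniteXi.FreyModularity) :
    ∀ ε : ℝ, 0 < ε → ∃ C : ℝ, ∀ a b : ℤ, IsCoprime a b → a * b * (a + b) ≠ 0 → ∀ (N : ℕ) [NeZero N],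
      (Literature.NumberTheory.EllipticCurves.freyCurve a b).conductorNorm ℤ = N →
      ∀ Nm : ℕ, Odd Nm → Squarefree Nm → Odd Nm.primeFactors.card → Nm ∣ N →
      Literature.NumberTheory.Automorphic.brandtXi (N / Nm) Nm
          (fun n => (Literature.NumberTheory.EllipticCurves.freyCurve a b).LFunction n) ≠ 0 →
      ∃ D : Literature.NumberTheory.EllipticCurves.ModularForms.ModularParametrizationData
        (Literature.NumberTheory.EllipticCurves.freyCurve a b) N,
        (∀ D' : Literature.NumberTheory.EllipticCurves.ModularForms.ModularParametrizationData
          (Literature.NumberTheory.EllipticCurves.freyCurve a b) N, D.deg ≤ D'.deg) ∧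
        ((Literature.NumberTheory.Automorphic.brandtXi (N / Nm) Nm
              (fun n => (Literature.NumberTheory.EllipticCurves.freyCurve a b).LFunction n) /
            (ordProj[2] (Literature.NumberTheory.Automorphic.brandtXi (N / Nm) Nm
                (fun n => (Literature.NumberTheory.EllipticCurves.freyCurve a b).LFunction n)) *
              ordProj[3] (Literature.NumberTheory.Automorphic.brandtXi (N / Nm) Nm
                (fun n => (Literature.NumberTheory.EllipticCurves.freyCurve a b).LFunction n))) : ℕ) : ℝ) ≤
          C * (N : ℝ) ^ ε * ((D.deg / (ordProj[2] D.deg * ordProj[3] D.deg) : ℕ) : ℝ) *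
            ((∏ q ∈ N.primeFactors, ((Literature.NumberTheory.EllipticCurves.freyCurve a b).minimalDiscriminantNorm
              ℤ).factorization q : ℕ) : ℝ) ^ 3 := by
  sorry


end Summit.ABC.ABC.Cruxes.SteinbergCore.ThetaTransferG3

end
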